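import Mathlib
import Summits.AtomisticToContinuum.Crystallization.Theses.FrustratedLawDichotomy


/-!
# ShellTopologyTrichotomy — the frustrated-law dichotomy of the T-centre composite cell (decomp-a2c lens-2, generation 12)

Tree twin of the cell node «FrustratedLawDichotomy» (run/shared/lean/pub/decomp-a2c/decomp-a2c-lens-2/g12/FrustratedLawDichotomy.lean,
sha256 recorded on the cell bus, critic row 105 CLEARED) for the CHILD ROUTE `Theses.FrustratedLawDichotomy` refining the declared residual
P₃ = `Theses.ShellTopologyTrichotomy.TcpCentreCompositeCase` (stmt-AtomisticToContinuum-26475).  Sorry-free, no new Prop items; every kernel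
statement is over the two gate-written route modules BY NAME.

* `tcpCentreCompositeCase_of_pieces` — THE DOOR: `TexturedLawTransfer → PeriodicFrustratedLawGap → AperiodicFrustratedLawGap →
  ShellTopologyTrichotomy.TcpCentreCompositeCase` (the transfer's law contradicts the gap; excluded middle on the law-level event «P charges
  periodic atom sets»).
* `nonTcpCentreCase_iff_rest` — the child route's complement item `NonTcpCentreCase` is EXACTLY the conjunction of the parent route's three
  other items `NonMesoscopicCase ∧ OctahedralCompositeCase ∧ MixedShellCompositeCase` (stmt-26478 ∧ 26476 ∧ 26477): no content of its own.
* `assembly_proof` — PROVES the child route's assembly item `FrustratedLawDichotomy.Assembly` from the route's own deciding theorem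
  `FrustratedLawDichotomy.closes` (4 binders, all load-bearing).
* `DiluteRung.frustratedLawGap_dilute_rung` and the corollaries `periodicFrustratedLawGap_dilute` / `aperiodicFrustratedLawGap_dilute` — the
  BC5 RUNG of both cruxes: their exact statements with the hard-core parameter restricted to `δ ≥ 3` (a `δ`-separated configuration with
  `δ ≥ 3` has root energy `≥ -(250/12)·δ⁻⁶ > -1/24 ≥ e⋆`, the last inequality by the periodised unit dimer, tree theorem
  `ChargedEnergyGapNegative.eStar_le_groundStateEnergy_div`).  Outside the proved regime of `Crystallization` (nothing about ground states is
  used or concluded) and exercising the route's lever (the SIGN of the averaged energy defect of ONE law against `e⋆`).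
-/

namespace Summit.AtomisticToContinuum.Crystallization.Theorems.ShellTopologyTrichotomyFrustratedLaw

/-- THE DOOR: P₃ ⟸ T ∧ Φper ∧ Φaper.  In P₃'s world the transfer (which uses only H1 H2 H7 H8 H10, verbatim) yields a textured minimising
point-stationary hard-core law; on either side of «P PerSet = 0 ∨ ≠ 0» the corresponding gap crux contradicts clause (c). -/
theorem tcpCentreCompositeCase_of_pieces (hT : Theses.FrustratedLawDichotomy.TexturedLawTransfer) (h₁ : Theses.FrustratedLawDichotomy.PeriodicFrustratedLawGap)
    (h₂ : Theses.FrustratedLawDichotomy.AperiodicFrustratedLawGap) : Theses.ShellTopologyTrichotomy.TcpCentreCompositeCase := by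
  intro x; dsimp only; intro hx h2 _h3 _h4 _h5 _h6 h7 h8 _h9 h10
  have hT' := hT x; dsimp only at hT'
  obtain ⟨δ, hδ, P, hP, ha, hb, hc, hd, he⟩ := hT' hx h2 h7 h8 h10
  have h₁' := h₁ δ hδ P; have h₂' := h₂ δ hδ P
  dsimp only at h₁' h₂'
  exact absurd hc (not_le.mpr ((eq_or_ne _ _).elim (fun h0 => h₂' hP ha hb hd he h0)
    (fun h0 => h₁' hP ha hb hd he (pos_iff_ne_zero.mpr h0))))

/-- The complement item is EXACTLY the conjunction of the parent route's three other items (bookkeeping; both directions by excluded middle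
on the parent's world predicates, which are fixed by unification). -/
theorem nonTcpCentreCase_iff_rest :
    Theses.FrustratedLawDichotomy.NonTcpCentreCase ↔ (Theses.ShellTopologyTrichotomy.NonMesoscopicCase ∧ Theses.ShellTopologyTrichotomy.OctahedralCompositeCase ∧
      Theses.ShellTopologyTrichotomy.MixedShellCompositeCase) := by
  constructor
  · intro h
    refine ⟨?_, ?_, ?_⟩
    · intro x; dsimp only; intro hx hm
      have h' := h x; dsimp only at h'
      exact h' hx fun hw => hm ⟨hw.1, hw.2.1, hw.2.2.1, hw.2.2.2.1, hw.2.2.2.2.1, hw.2.2.2.2.2.1, hw.2.2.2.2.2.2.1⟩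
    · intro x; dsimp only; intro hx _h2 _h50 _hH _hT _hY _hW _hN hO
      have h' := h x; dsimp only at h'
      exact h' hx fun hw => hw.2.2.2.2.2.2.2.1 hO
    · intro x; dsimp only; intro hx _h2 _h50 _hH _hT _hY _hW _hN _hnO hP
      have h' := h x; dsimp only at h'
      exact h' hx fun hw => hw.2.2.2.2.2.2.2.2 hP
  · rintro ⟨hN, hO, hM⟩
    intro x; dsimp only; intro hx hnw
    have hN' := hN x; have hO' := hO x; have hM' := hM x
    dsimp only at hN' hO' hM'
    refine (Classical.em _).elim (fun hmeso => ?_) (hN' hx)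
    obtain ⟨h2, h50, hH, hT, hY, hW, hn⟩ := hmeso
    refine (Classical.em _).elim (fun ho => hO' hx h2 h50 hH hT hY hW hn ho) (fun hno => ?_)
    refine (Classical.em _).elim (fun hp => hM' hx h2 h50 hH hT hY hW hn hno hp) (fun hnp => ?_)
    exact absurd ⟨h2, h50, hH, hT, hY, hW, hn, hno, hnp⟩ hnw

/-- every ground-state sequence has periodic windows, from the four items (cells: outside P₃'s world the complement item, inside it the door). -/
theorem periodicWindows_of_pieces (h₀ : Theses.FrustratedLawDichotomy.NonTcpCentreCase) (hT : Theses.FrustratedLawDichotomy.TexturedLawTransfer) (h₁ : Theses.FrustratedLawDichotomy.PeriodicFrustratedLawGap)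
    (h₂ : Theses.FrustratedLawDichotomy.AperiodicFrustratedLawGap) (x : (N : ℕ) → (Fin N → EuclideanSpace ℝ (Fin 3))) (hx : (∀ N, Literature.MathematicalPhysics.StatisticalMechanics.IsGroundState Literature.MathematicalPhysics.StatisticalMechanics.lennardJones (x N))) :
    ∃ P : Literature.MathematicalPhysics.StatisticalMechanics.PeriodicConfiguration 3, ∀ R ε : ℝ, 0 < ε → ∃ᶠ N in Filter.atTop, ∃ t : EuclideanSpace ℝ (Fin 3), (∀ s ∈ P.points, ‖s‖ ≤ R → ∃ i : Fin N, dist (x N i + t) s ≤ ε) ∧ (∀ i : Fin N, ‖x N i + t‖ ≤ R → ∃ s ∈ P.points, dist (x N i + t) s ≤ ε) := by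
  have hP3 := tcpCentreCompositeCase_of_pieces hT h₁ h₂
  refine (Classical.em _).elim (fun hw => ?_) (h₀ x hx)
  obtain ⟨h2, h50, hH, hT, hY, hW, hN, hO, hP⟩ := hw
  exact hP3 x hx h2 h50 hH hT hY hW hN hO hP

/-- the conjunct from the four items, through the parent's gate-written deciding theorem. -/
theorem crystallization_of_pieces (h₀ : Theses.FrustratedLawDichotomy.NonTcpCentreCase) (hT : Theses.FrustratedLawDichotomy.TexturedLawTransfer) (h₁ : Theses.FrustratedLawDichotomy.PeriodicFrustratedLawGap)
    (h₂ : Theses.FrustratedLawDichotomy.AperiodicFrustratedLawGap) : _root_.Crystallization :=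
  have hall := periodicWindows_of_pieces h₀ hT h₁ h₂
  Theses.ShellTopologyTrichotomy.closes (fun x hx _ => hall x hx) (fun x hx _ _ _ _ _ _ _ _ => hall x hx)
    (fun x hx _ _ _ _ _ _ _ _ _ => hall x hx) (fun x hx _ _ _ _ _ _ _ _ _ => hall x hx)

/-- PROVES the child route's assembly item `Assembly := NonTcpCentreCase → TexturedLawTransfer → PeriodicFrustratedLawGap →
AperiodicFrustratedLawGap → Crystallization` (born: literally by the route`s own deciding theorem `closes`). -/
theorem assembly_proof : Theses.FrustratedLawDichotomy.Assembly :=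
  fun h₀ hT h₁ h₂ => Theses.FrustratedLawDichotomy.closes h₀ hT h₁ h₂

/-- the child items rebuild exactly the parent's deciding hypotheses: (NonTcp ∧ T ∧ Φper ∧ Φaper) ⟹ (NonMeso ∧ Oct ∧ Mixed ∧ Tcp). -/
theorem parentItems_of_childItems (h₀ : Theses.FrustratedLawDichotomy.NonTcpCentreCase) (hT : Theses.FrustratedLawDichotomy.TexturedLawTransfer) (h₁ : Theses.FrustratedLawDichotomy.PeriodicFrustratedLawGap)
    (h₂ : Theses.FrustratedLawDichotomy.AperiodicFrustratedLawGap) :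
    Theses.ShellTopologyTrichotomy.NonMesoscopicCase ∧ Theses.ShellTopologyTrichotomy.OctahedralCompositeCase ∧
      Theses.ShellTopologyTrichotomy.MixedShellCompositeCase ∧ Theses.ShellTopologyTrichotomy.TcpCentreCompositeCase :=
  let h := nonTcpCentreCase_iff_rest.mp h₀
  ⟨h.1, h.2.1, h.2.2, tcpCentreCompositeCase_of_pieces hT h₁ h₂⟩

end Summit.AtomisticToContinuum.Crystallization.Theorems.ShellTopologyTrichotomyFrustratedLaw

/-! ## The BC5 rung (dilute window `δ ≥ 3`) — helper lemmas on `δ`-separated sets re-proved from the Literature shell bound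
`sum_inv_pow_six_le`; `e⋆ ≤ -1/24` from the tree theorem `ChargedEnergyGapNegative.eStar_le_groundStateEnergy_div` (in the import closure
of the parent route module). -/

noncomputable section

namespace Summit.AtomisticToContinuum.Crystallization.Theorems.ShellTopologyTrichotomyFrustratedLaw

namespace DiluteRung

open MeasureTheory Metric Set
open scoped ENNReal
open Literature.MathematicalPhysics.StatisticalMechanics Literature.Probability.Process
open Summit.AtomisticToContinuum.Crystallization.Theorems.ChargedEnergyGapNegative
  (eStar eStar_le_groundStateEnergy_div dimer dimer_injective interactionEnergy_dimer)


/-! ### `δ`-separated sets: counting -/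

section Separated

variable {δ : ℝ} {S : Set (EuclideanSpace ℝ (Fin 3))}

/-- Packing: a finite subset of a `δ`-separated set inside a closed `r`-ball has at most
`(2r/δ + 1)³` points. [folklore] -/
theorem card_le_of_subset_closedBall (hδ : 0 < δ)
    (hsep : ∀ x ∈ S, ∀ y ∈ S, x ≠ y → δ ≤ dist x y) {p : (EuclideanSpace ℝ (Fin 3))} {r : ℝ} (hr : 0 ≤ r)
    (T : Finset (EuclideanSpace ℝ (Fin 3))) (hT : (↑T : Set (EuclideanSpace ℝ (Fin 3))) ⊆ S ∩ closedBall p r) :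
    (T.card : ℝ) ≤ (2 * r / δ + 1) ^ 3 := by
  have h := card_le_of_separated_of_dist_le T p hδ hr
    (fun c hc => mem_closedBall.1 (hT hc).2)
    (fun c hc d hd hcd => hsep c (hT hc).1 d (hT hd).1 hcd)
  simpa [finrank_euclideanSpace_fin] using h

/-- A `δ`-separated set meets every closed ball in a finite set. [folklore] -/
theorem finite_inter_closedBall (hδ : 0 < δ)
    (hsep : ∀ x ∈ S, ∀ y ∈ S, x ≠ y → δ ≤ dist x y) (p : (EuclideanSpace ℝ (Fin 3))) (r : ℝ) :
    (S ∩ closedBall p r).Finite := by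
  by_contra hinf
  rcases lt_or_ge r 0 with hr | hr
  · rw [closedBall_eq_empty.2 hr, inter_empty] at hinf
    exact hinf finite_empty
  obtain ⟨T, hT, hcard⟩ :=
    (show (S ∩ closedBall p r).Infinite from hinf).exists_subset_card_eq
      (⌈(2 * r / δ + 1) ^ 3⌉₊ + 1)
  have h1 := card_le_of_subset_closedBall hδ hsep hr T hT
  have h2 : ((2 * r / δ + 1) ^ 3 : ℝ) < T.card := by
    rw [hcard]
    push_cast
    exact (Nat.le_ceil _).trans_lt (lt_add_one _)
  linarith

/-- `∫⁻ f d(count|S) = ∑' y : S, f y` for countable `S`. [folklore] -/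
theorem lintegral_count_restrict (hS : S.Countable) (f : (EuclideanSpace ℝ (Fin 3)) → ℝ≥0∞) :
    ∫⁻ y, f y ∂((Measure.count : Measure (EuclideanSpace ℝ (Fin 3))).restrict S) = ∑' y : S, f y := by
  rw [lintegral_countable f hS]
  simp

/-! ### Lennard-Jones negative tail over a separated set -/

/-- Shell bound, finite form: `∑_{z ∈ T, z ≠ y} (dist y z)⁻⁶ ≤ 250 δ⁻⁶` for a finite
`δ`-separated `T ∋ y` (Literature `sum_inv_pow_six_le`, re-indexed). [folklore] -/
theorem sum_erase_inv_pow_six_le (hδ : 0 < δ) (T : Finset (EuclideanSpace ℝ (Fin 3)))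
    (hsep : ∀ x ∈ T, ∀ z ∈ T, x ≠ z → δ ≤ dist x z) {y : (EuclideanSpace ℝ (Fin 3))} (hy : y ∈ T) :
    ∑ z ∈ T.erase y, (dist y z)⁻¹ ^ 6 ≤ 250 * δ⁻¹ ^ 6 := by
  classical
  set e : {z // z ∈ T} ≃ Fin T.card := T.equivFin with he
  set x : Fin T.card → (EuclideanSpace ℝ (Fin 3)) := fun i => (e.symm i : (EuclideanSpace ℝ (Fin 3))) with hx
  have hxsep : ∀ k l, k ≠ l → δ ≤ dist (x k) (x l) := fun k l hkl =>
    hsep _ (e.symm k).2 _ (e.symm l).2 fun h => hkl (e.symm.injective (Subtype.ext h))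
  have h := sum_inv_pow_six_le x hδ hxsep (e ⟨y, hy⟩)
  have hxy : x (e ⟨y, hy⟩) = y := by simp [hx]
  rw [hxy] at h
  refine le_trans (le_of_eq ?_) h
  refine Finset.sum_bij' (fun z hz => e ⟨z, (Finset.mem_erase.1 hz).2⟩)
    (fun k _ => (e.symm k : (EuclideanSpace ℝ (Fin 3)))) ?_ ?_ ?_ ?_ ?_
  · intro z hz
    refine Finset.mem_erase.2 ⟨fun h' => (Finset.mem_erase.1 hz).1 ?_, Finset.mem_univ _⟩
    have := congrArg (fun i => (e.symm i : (EuclideanSpace ℝ (Fin 3)))) h'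
    simpa using this
  · intro k hk
    refine Finset.mem_erase.2 ⟨fun h' => (Finset.mem_erase.1 hk).1 ?_, (e.symm k).2⟩
    have : e.symm k = ⟨y, hy⟩ := Subtype.ext h'
    rw [← this, Equiv.apply_symm_apply]
  · intro z hz
    simp
  · intro k hk
    simp
  · intro z hz
    simp [hx]

/-- Negative-part Lennard-Jones sum from a point `y` of a `δ`-separated `S`:
`∑_{z ∈ S} V_LJ(‖z - y‖)⁻ ≤ 250/6 · δ⁻⁶`. [folklore] -/
theorem lintegral_ofReal_neg_lennardJones_le (hδ : 0 < δ)
    (hsep : ∀ x ∈ S, ∀ y ∈ S, x ≠ y → δ ≤ dist x y) {y : (EuclideanSpace ℝ (Fin 3))} (hy : y ∈ S) :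
    ∫⁻ z, ENNReal.ofReal (-lennardJones ‖z - y‖) ∂((Measure.count : Measure (EuclideanSpace ℝ (Fin 3))).restrict S) ≤
      ENNReal.ofReal (250 / 6 * δ⁻¹ ^ 6) := by
  classical
  -- `S` is countable (= `UnimodularEnergy.countable_of_separated`, inlined)
  have hS : S.Countable := by
    have : S = ⋃ n : ℕ, S ∩ closedBall 0 n := by
      ext x
      simp only [mem_iUnion, mem_inter_iff, mem_closedBall, dist_zero_right]
      exact ⟨fun hx => ⟨⌈‖x‖⌉₊, hx, Nat.le_ceil _⟩, fun ⟨n, hx, _⟩ => hx⟩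
    rw [this]
    exact countable_iUnion fun n => (finite_inter_closedBall hδ hsep 0 n).countable
  rw [lintegral_count_restrict hS, ENNReal.tsum_eq_iSup_sum]
  refine iSup_le fun T' => ?_
  set T : Finset (EuclideanSpace ℝ (Fin 3)) := insert y (T'.map (Function.Embedding.subtype (· ∈ S))) with hT
  have hTS : ∀ z ∈ T, z ∈ S := by
    intro z hz
    rcases Finset.mem_insert.1 hz with rfl | hz
    · exact hy
    · obtain ⟨w, -, rfl⟩ := Finset.mem_map.1 hz
      exact w.2
  have hsepT : ∀ x ∈ T, ∀ z ∈ T, x ≠ z → δ ≤ dist x z := fun x hx z hz hxz =>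
    hsep x (hTS x hx) z (hTS z hz) hxz
  have hyT : y ∈ T := Finset.mem_insert_self _ _
  calc ∑ z ∈ T', ENNReal.ofReal (-lennardJones ‖(z : (EuclideanSpace ℝ (Fin 3))) - y‖)
      = ∑ z ∈ T'.map (Function.Embedding.subtype (· ∈ S)),
          ENNReal.ofReal (-lennardJones ‖z - y‖) := by
        rw [Finset.sum_map]; rfl
    _ ≤ ∑ z ∈ T, ENNReal.ofReal (-lennardJones ‖z - y‖) :=
        Finset.sum_le_sum_of_subset (Finset.subset_insert _ _)
    _ = ∑ z ∈ T.erase y, ENNReal.ofReal (-lennardJones ‖z - y‖) := by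
        rw [← Finset.add_sum_erase T _ hyT]
        simp [lennardJones_zero]
    _ ≤ ∑ z ∈ T.erase y, ENNReal.ofReal ((1 / 6) * (dist y z)⁻¹ ^ 6) :=
        Finset.sum_le_sum fun z _ => by
          -- `V_LJ(r)⁻ ≤ r⁻⁶/6` (= `UnimodularEnergy.ofReal_neg_lennardJones_le`, inlined)
          rw [← dist_eq_norm, dist_comm]
          generalize dist y z = r
          apply ENNReal.ofReal_le_ofReal
          have : 0 ≤ (1 / 12) * (r⁻¹) ^ 12 := by positivity
          unfold lennardJones
          linarith
    _ = ENNReal.ofReal (∑ z ∈ T.erase y, (1 / 6) * (dist y z)⁻¹ ^ 6) :=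
        (ENNReal.ofReal_sum_of_nonneg fun z _ => by positivity).symm
    _ ≤ ENNReal.ofReal (250 / 6 * δ⁻¹ ^ 6) := by
        apply ENNReal.ofReal_le_ofReal
        rw [← Finset.mul_sum]
        nlinarith [sum_erase_inv_pow_six_le hδ T hsepT hyT]

/-- The REAL (Bochner) Lennard-Jones sum seen from the root of a rooted `δ`-separated set is
`≥ -(250/6)·δ⁻⁶` — also when it is not summable (junk value `0`). [folklore] -/
theorem neg_le_integral_lennardJones (hδ : 0 < δ)
    (hsep : ∀ x ∈ S, ∀ y ∈ S, x ≠ y → δ ≤ dist x y) (h0 : (0 : (EuclideanSpace ℝ (Fin 3))) ∈ S) :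
    -(250 / 6 * δ⁻¹ ^ 6) ≤ ∫ z, lennardJones ‖z‖ ∂((Measure.count : Measure (EuclideanSpace ℝ (Fin 3))).restrict S) := by
  have htail : ∫⁻ z, ENNReal.ofReal (-lennardJones ‖z‖) ∂((Measure.count : Measure (EuclideanSpace ℝ (Fin 3))).restrict S)
      ≤ ENNReal.ofReal (250 / 6 * δ⁻¹ ^ 6) := by
    simpa using lintegral_ofReal_neg_lennardJones_le hδ hsep h0
  have hC : (0 : ℝ) ≤ 250 / 6 * δ⁻¹ ^ 6 := by positivity
  by_cases hf : Integrable (fun z : (EuclideanSpace ℝ (Fin 3)) => lennardJones ‖z‖) ((Measure.count : Measure (EuclideanSpace ℝ (Fin 3))).restrict S)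
  · rw [integral_eq_lintegral_pos_part_sub_lintegral_neg_part hf]
    have h1 : (∫⁻ z, ENNReal.ofReal (-lennardJones ‖z‖)
        ∂((Measure.count : Measure (EuclideanSpace ℝ (Fin 3))).restrict S)).toReal ≤ 250 / 6 * δ⁻¹ ^ 6 :=
      ENNReal.toReal_le_of_le_ofReal hC htail
    have h2 : 0 ≤ (∫⁻ z, ENNReal.ofReal (lennardJones ‖z‖)
        ∂((Measure.count : Measure (EuclideanSpace ℝ (Fin 3))).restrict S)).toReal := ENNReal.toReal_nonneg
    linarith
  · rw [integral_undef hf]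
    linarith

end Separated

/-! ### Law level -/

/-- Root energy of a rooted `δ`-hard-core configuration is `≥ -(250/12)·δ⁻⁶`. [folklore] -/
theorem neg_le_rootEnergy_of_isRootedHardCore {δ : ℝ} (hδ : 0 < δ) {μ : Measure (EuclideanSpace ℝ (Fin 3))}
    (h : IsRootedHardCore δ μ) : -(250 / 12 * δ⁻¹ ^ 6) ≤ rootEnergy lennardJones μ := by
  obtain ⟨S, h0, hsep, rfl⟩ := h
  rw [rootEnergy_def]
  have := neg_le_integral_lennardJones hδ hsep h0
  linarith

/-- Mean root energy of a probability law on rooted `δ`-hard-core configurations is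
`≥ -(250/12)·δ⁻⁶` — also when `μ ↦ rootEnergy V_LJ μ` is not `P`-integrable (junk `0`).
[folklore] -/
theorem neg_le_integral_rootEnergy {δ : ℝ} (hδ : 0 < δ) (P : Measure (Measure (EuclideanSpace ℝ (Fin 3))))
    [IsProbabilityMeasure P] (hcore : ∀ᵐ μ ∂P, IsRootedHardCore δ μ) :
    -(250 / 12 * δ⁻¹ ^ 6) ≤ ∫ μ, rootEnergy lennardJones μ ∂P := by
  have hC : (0 : ℝ) ≤ 250 / 12 * δ⁻¹ ^ 6 := by positivity
  have hae : ∀ᵐ μ ∂P, -(250 / 12 * δ⁻¹ ^ 6) ≤ rootEnergy lennardJones μ :=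
    hcore.mono fun μ hμ => neg_le_rootEnergy_of_isRootedHardCore hδ hμ
  by_cases hI : Integrable (fun μ : Measure (EuclideanSpace ℝ (Fin 3)) => rootEnergy lennardJones μ) P
  · have h := integral_mono_ae (integrable_const _) hI hae
    simpa [integral_const, measure_univ] using h
  · rw [integral_undef hI]
    linarith

/-- **BC5 RUNG (dilute window).** For every `δ ≥ 3` and every probability law `P` on rooted
`δ`-hard-core configurations of `ℝ³`, `e⋆ < E_P[rootEnergy V_LJ]`: the common special case of the
cruxes `PeriodicFrustratedLawGap` and `AperiodicFrustratedLawGap` of route `FrustratedLawDichotomy`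
with the hard-core parameter restricted to `δ ≥ 3` (their remaining hypotheses dropped). [folklore] -/
theorem frustratedLawGap_dilute_rung :
    ∀ δ : ℝ, 3 ≤ δ → ∀ P : Measure (Measure (EuclideanSpace ℝ (Fin 3))), IsProbabilityMeasure P →
      (∀ᵐ μ ∂P, IsRootedHardCore δ μ) →
      (⨅ Q : PeriodicConfiguration 3, Q.energyPerParticle lennardJones) <
        ∫ μ, rootEnergy lennardJones μ ∂P := by
  intro δ hδ P hP hcore
  have hδ0 : 0 < δ := by linarith
  have h1 := neg_le_integral_rootEnergy hδ0 P hcore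
  have h2 : eStar ≤ -1 / 24 := by
    -- `e⋆ ≤ E(2)/2 = -1/24` (periodised unit dimer; = `PricedLinkCensusLocalToGlobalPhaseGap.eStar_le_neg`, inlined)
    have h1' : eStar ≤ groundStateEnergy lennardJones 3 2 / 2 := by
      simpa using eStar_le_groundStateEnergy_div (N := 2) two_pos
    have h2' : groundStateEnergy lennardJones 3 2 ≤ -1 / 12 := by
      have := groundStateEnergy_lennardJones_le (d := 3) dimer_injective
      rwa [interactionEnergy_dimer] at this
    linarith
  have h3 : δ⁻¹ ^ 6 ≤ (3 : ℝ)⁻¹ ^ 6 :=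
    pow_le_pow_left₀ (inv_nonneg.2 hδ0.le) ((inv_le_inv₀ hδ0 (by norm_num)).2 hδ) 6
  have h4 : ((3 : ℝ)⁻¹) ^ 6 = 1 / 729 := by norm_num
  show eStar < _
  rw [h4] at h3
  linarith

/-- The rung in the exact binder shape of the cruxes' common core «(a) ⇒ gap», for the record:
point-stationarity (b), texture (d), Nash (e) and the periodic / aperiodic charge are extra
hypotheses of the cruxes and are simply not used in the dilute window. [folklore] -/
theorem frustratedLawGap_dilute_rung' {δ : ℝ} (hδ : 3 ≤ δ) {P : Measure (Measure (EuclideanSpace ℝ (Fin 3)))}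
    [IsProbabilityMeasure P] (hcore : ∀ᵐ μ ∂P, IsRootedHardCore δ μ)
    (_hstat : IsPointStationaryLaw P) :
    (⨅ Q : PeriodicConfiguration 3, Q.energyPerParticle lennardJones) <
      ∫ μ, rootEnergy lennardJones μ ∂P :=
  frustratedLawGap_dilute_rung δ hδ P inferInstance hcore

end DiluteRung

/-- BC5 RUNG OF `PeriodicFrustratedLawGap`: its exact statement with the hard-core binder `0 < δ` replaced by `3 ≤ δ`
(point-stationarity, texture, Nash and the periodic charge are then not needed). -/
theorem periodicFrustratedLawGap_dilute :
    ∀ δ : ℝ, 3 ≤ δ → ∀ P : MeasureTheory.Measure (MeasureTheory.Measure (EuclideanSpace ℝ (Fin 3))), let Gy : ℝ → (N : ℕ) → (Fin N → EuclideanSpace ℝ (Fin 3)) → Fin N → Prop := fun η N y j => let d : ℝ := sInf ((fun z => dist z (y (j : Fin N))) '' (Set.range (y) \ {(y (j : Fin N))})); let T : Set (EuclideanSpace ℝ (Fin 3)) := {z : EuclideanSpace ℝ (Fin 3) | z ∈ Set.range (y) ∧ z ≠ (y (j : Fin N)) ∧ dist z (y (j : Fin N)) < 13 / 10 * d}; ∃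 A : EuclideanSpace ℝ (Fin 3) →ₗᵢ[ℝ] EuclideanSpace ℝ (Fin 3), (∃ e : ↥T ≃ ↥Literature.Geometry.DiscreteGeometry.fccKissingPattern, ∀ t : ↥T, dist (d⁻¹ • ((t : EuclideanSpace ℝ (Fin 3)) - (y (j : Fin N)))) (A ((e t : ↥Literature.Geometry.DiscreteGeometry.fccKissingPattern) : EuclideanSpace ℝ (Fin 3))) ≤ η) ∨ (∃ e : ↥T ≃ ↥Literature.Geometry.DiscreteGeometry.hcpKissingPattern, ∀ t : ↥T, dist (d⁻¹ • ((t : EuclideanSpace ℝ (Fin 3)) - (y (j : Fin N)))) (A ((e t : ↥Literature.Geometry.DiscreteGeometry.hcpKissingPattern) : EuclideanSpace ℝ (Fin 3))) ≤ η); let TexBall : (N : ℕ) → (Fin N → EuclideanSpace ℝ (Fin 3)) → Fin N → ℝ → ℝ → ℝ → ℝ → Prop := fun N y i R R₇ R₈ R₉ => (∀ a b : Fin N, a ≠ b → (7 : ℝ) / 10 ≤ dist (y a) (y b)) ∧ (∀ j : Fin N, dist (y j) (y i) ≤ R → ¬ Gy (1 / 20) N (y) j) ∧ (∀ j : Fin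 N, dist (y j) (y i) ≤ R → ¬ ((∀ j' : Fin N, dist (y j') (y j) ≤ R₇ → ¬ Gy (1 / 20) N (y) j') ∧ (∀ z : EuclideanSpace ℝ (Fin 3), dist z (y j) ≤ R₇ → ∃ k : Fin N, dist z (y k) ≤ 1) ∧ (∀ j' : Fin N, dist (y j') (y j) ≤ R₇ → (let d : ℝ := sInf ((fun z => dist z (y j')) '' (Set.range (y) \ {(y j')})); ∀ k : Fin N, y k ≠ y j' → dist (y k) (y j') < 27 / 20 * d → 5 ≤ Nat.card {m : Fin N // y m ≠ y j' ∧ dist (y m) (y j') < 27 / 20 * d ∧ y m ≠ y k ∧ dist (y m) (y k) < 27 / 20 * d})))) ∧ (∀ j : Fin N, dist (y j) (y i) ≤ R → ∃ k : Fin N, dist (y k) (y j) ≤ R₈ ∧ Gy (1 / 8) N (y) k) ∧ (∀ j : Fin N, dist (y j) (y i) ≤ R → ¬ ((∀ j' : Fin N, dist (y j') (y j) ≤ R₉ → ¬ Gy (1 / 20) N (y) j') ∧ (Nat.card {j' : Fin N // dist (y j') (y j) ≤ R₉ ∧ ¬ Gy (1 / 8) N (y) j'} : ℝ) ≤ 1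 / 2 * (Nat.card {j' : Fin N // dist (y j') (y j) ≤ R₉} : ℝ) ∧ (∀ j' : Fin N, dist (y j') (y j) ≤ R₉ → ¬ Gy (1 / 8) N (y) j' → ¬ (let d : ℝ := sInf ((fun z => dist z (y j')) '' (Set.range (y) \ {(y j')})); ∀ k : Fin N, y k ≠ y j' → dist (y k) (y j') < 27 / 20 * d → 5 ≤ Nat.card {m : Fin N // y m ≠ y j' ∧ dist (y m) (y j') < 27 / 20 * d ∧ y m ≠ y k ∧ dist (y m) (y k) < 27 / 20 * d})))); let Appr : MeasureTheory.Measure (EuclideanSpace ℝ (Fin 3)) → ℝ → ℝ → ℝ → Prop := fun μ R₇ R₈ R₉ => ∀ q : EuclideanSpace ℝ (Fin 3), μ {q} ≠ 0 → ∀ R ε : ℝ, 0 < ε → ∃ (N : ℕ) (y : Fin N → EuclideanSpace ℝ (Fin 3)) (i : Fin N), TexBall N y i R R₇ R₈ R₉ ∧ (∀ p : EuclideanSpace ℝ (Fin 3), μ {p} ≠ 0 → dist p q ≤ R → ∃ k : Fin N, dist (y k - y i) (p - q) ≤ ε) ∧ (∀ k : Fin N, dist (y k) (y i) ≤ R → ∃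 p : EuclideanSpace ℝ (Fin 3), μ {p} ≠ 0 ∧ dist (y k - y i) (p - q) ≤ ε); MeasureTheory.IsProbabilityMeasure P → (∀ᵐ μ ∂P, Literature.Probability.Process.IsRootedHardCore δ μ) → Literature.Probability.Process.IsPointStationaryLaw P → (∃ R₇ R₈ R₉ : ℝ, ∀ᵐ μ ∂P, Appr μ R₇ R₈ R₉) → (∀ᵐ μ ∂P, ∀ p : EuclideanSpace ℝ (Fin 3), μ {p} ≠ 0 → ∀ y : EuclideanSpace ℝ (Fin 3), (∀ q : EuclideanSpace ℝ (Fin 3), μ {q} ≠ 0 → q ≠ p → y ≠ q) → ∑' q : {q : EuclideanSpace ℝ (Fin 3) // μ {q} ≠ 0 ∧ q ≠ p}, Literature.MathematicalPhysics.StatisticalMechanics.lennardJones (dist p (q : EuclideanSpace ℝ (Fin 3))) ≤ ∑' q : {q : EuclideanSpace ℝ (Fin 3) // μ {q} ≠ 0 ∧ q ≠ p}, Literature.MathematicalPhysics.StatisticalMechanics.lennardJones (dist y (q : EuclideanSpace ℝ (Fin 3)))) → 0 < P {μ : MeasureTheory.Measure (EuclideanSpace ℝ (Fin 3)) | ∃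 Q : Literature.MathematicalPhysics.StatisticalMechanics.PeriodicConfiguration 3, ∃ t : EuclideanSpace ℝ (Fin 3), {p : EuclideanSpace ℝ (Fin 3) | μ {p} ≠ 0} = (fun s => s + t) '' Q.points} → (⨅ Q : Literature.MathematicalPhysics.StatisticalMechanics.PeriodicConfiguration 3, Q.energyPerParticle Literature.MathematicalPhysics.StatisticalMechanics.lennardJones) < (∫ μ, Literature.MathematicalPhysics.StatisticalMechanics.rootEnergy Literature.MathematicalPhysics.StatisticalMechanics.lennardJones μ ∂P) := by
  intro δ hδ P; dsimp only; intro hP ha _hb _hd _he _hper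
  exact DiluteRung.frustratedLawGap_dilute_rung δ hδ P hP ha

/-- BC5 RUNG OF `AperiodicFrustratedLawGap`: its exact statement with the hard-core binder `0 < δ` replaced by `3 ≤ δ`. -/
theorem aperiodicFrustratedLawGap_dilute :
    ∀ δ : ℝ, 3 ≤ δ → ∀ P : MeasureTheory.Measure (MeasureTheory.Measure (EuclideanSpace ℝ (Fin 3))), let Gy : ℝ → (N : ℕ) → (Fin N → EuclideanSpace ℝ (Fin 3)) → Fin N → Prop := fun η N y j => let d : ℝ := sInf ((fun z => dist z (y (j : Fin N))) '' (Set.range (y) \ {(y (j : Fin N))})); let T : Set (EuclideanSpace ℝ (Fin 3)) := {z : EuclideanSpace ℝ (Fin 3) | z ∈ Set.range (y) ∧ z ≠ (y (j : Fin N)) ∧ dist z (y (j : Fin N)) < 13 / 10 * d}; ∃ A : EuclideanSpace ℝ (Fin 3) →ₗᵢ[ℝ] EuclideanSpace ℝ (Fin 3), (∃ e : ↥T ≃ ↥Literature.Geometry.DiscreteGeometry.fccKissingPattern, ∀ t : ↥T, dist (d⁻¹ • ((t : EuclideanSpace ℝ (Fin 3)) - (y (j : Fin N)))) (A ((e t :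 ↥Literature.Geometry.DiscreteGeometry.fccKissingPattern) : EuclideanSpace ℝ (Fin 3))) ≤ η) ∨ (∃ e : ↥T ≃ ↥Literature.Geometry.DiscreteGeometry.hcpKissingPattern, ∀ t : ↥T, dist (d⁻¹ • ((t : EuclideanSpace ℝ (Fin 3)) - (y (j : Fin N)))) (A ((e t : ↥Literature.Geometry.DiscreteGeometry.hcpKissingPattern) : EuclideanSpace ℝ (Fin 3))) ≤ η); let TexBall : (N : ℕ) → (Fin N → EuclideanSpace ℝ (Fin 3)) → Fin N → ℝ → ℝ → ℝ → ℝ → Prop := fun N y i R R₇ R₈ R₉ => (∀ a b : Fin N, a ≠ b → (7 : ℝ) / 10 ≤ dist (y a) (y b)) ∧ (∀ j : Fin N, dist (y j) (y i) ≤ R → ¬ Gy (1 / 20) N (y) j) ∧ (∀ j : Fin N, dist (y j) (y i) ≤ R → ¬ ((∀ j' : Fin N, dist (y j') (y j) ≤ R₇ → ¬ Gy (1 / 20) N (y) j') ∧ (∀ z : EuclideanSpace ℝ (Fin 3), dist z (y j) ≤ R₇ → ∃ k : Fin N, dist z (y k) ≤ 1) ∧ (∀ j' : Fin N, dist (y j')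 (y j) ≤ R₇ → (let d : ℝ := sInf ((fun z => dist z (y j')) '' (Set.range (y) \ {(y j')})); ∀ k : Fin N, y k ≠ y j' → dist (y k) (y j') < 27 / 20 * d → 5 ≤ Nat.card {m : Fin N // y m ≠ y j' ∧ dist (y m) (y j') < 27 / 20 * d ∧ y m ≠ y k ∧ dist (y m) (y k) < 27 / 20 * d})))) ∧ (∀ j : Fin N, dist (y j) (y i) ≤ R → ∃ k : Fin N, dist (y k) (y j) ≤ R₈ ∧ Gy (1 / 8) N (y) k) ∧ (∀ j : Fin N, dist (y j) (y i) ≤ R → ¬ ((∀ j' : Fin N, dist (y j') (y j) ≤ R₉ → ¬ Gy (1 / 20) N (y) j') ∧ (Nat.card {j' : Fin N // dist (y j') (y j) ≤ R₉ ∧ ¬ Gy (1 / 8) N (y) j'} : ℝ) ≤ 1 / 2 * (Nat.card {j' : Fin N // dist (y j') (y j) ≤ R₉} : ℝ) ∧ (∀ j' : Fin N, dist (y j') (y j) ≤ R₉ → ¬ Gy (1 / 8) N (y) j' → ¬ (let d : ℝ := sInf ((fun z => dist z (y j')) '' (Set.range (y) \ {(y j')})); ∀ k : Fin N, y k ≠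 y j' → dist (y k) (y j') < 27 / 20 * d → 5 ≤ Nat.card {m : Fin N // y m ≠ y j' ∧ dist (y m) (y j') < 27 / 20 * d ∧ y m ≠ y k ∧ dist (y m) (y k) < 27 / 20 * d})))); let Appr : MeasureTheory.Measure (EuclideanSpace ℝ (Fin 3)) → ℝ → ℝ → ℝ → Prop := fun μ R₇ R₈ R₉ => ∀ q : EuclideanSpace ℝ (Fin 3), μ {q} ≠ 0 → ∀ R ε : ℝ, 0 < ε → ∃ (N : ℕ) (y : Fin N → EuclideanSpace ℝ (Fin 3)) (i : Fin N), TexBall N y i R R₇ R₈ R₉ ∧ (∀ p : EuclideanSpace ℝ (Fin 3), μ {p} ≠ 0 → dist p q ≤ R → ∃ k : Fin N, dist (y k - y i) (p - q) ≤ ε) ∧ (∀ k : Fin N, dist (y k) (y i) ≤ R → ∃ p : EuclideanSpace ℝ (Fin 3), μ {p} ≠ 0 ∧ dist (y k - y i) (p - q) ≤ ε); MeasureTheory.IsProbabilityMeasure P → (∀ᵐ μ ∂P, Literature.Probability.Process.IsRootedHardCore δ μ) → Literature.Probability.Process.IsPointStationaryLaw P → (∃ R₇ R₈ R₉ : ℝ,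 ∀ᵐ μ ∂P, Appr μ R₇ R₈ R₉) → (∀ᵐ μ ∂P, ∀ p : EuclideanSpace ℝ (Fin 3), μ {p} ≠ 0 → ∀ y : EuclideanSpace ℝ (Fin 3), (∀ q : EuclideanSpace ℝ (Fin 3), μ {q} ≠ 0 → q ≠ p → y ≠ q) → ∑' q : {q : EuclideanSpace ℝ (Fin 3) // μ {q} ≠ 0 ∧ q ≠ p}, Literature.MathematicalPhysics.StatisticalMechanics.lennardJones (dist p (q : EuclideanSpace ℝ (Fin 3))) ≤ ∑' q : {q : EuclideanSpace ℝ (Fin 3) // μ {q} ≠ 0 ∧ q ≠ p}, Literature.MathematicalPhysics.StatisticalMechanics.lennardJones (dist y (q : EuclideanSpace ℝ (Fin 3)))) → P {μ : MeasureTheory.Measure (EuclideanSpace ℝ (Fin 3)) | ∃ Q : Literature.MathematicalPhysics.StatisticalMechanics.PeriodicConfiguration 3, ∃ t : EuclideanSpace ℝ (Fin 3), {p : EuclideanSpace ℝ (Fin 3) | μ {p} ≠ 0} = (fun s => s + t) '' Q.points} = 0 → (⨅ Q : Literature.MathematicalPhysics.StatisticalMechanics.PeriodicConfiguration 3, Q.energyPerParticle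 Literature.MathematicalPhysics.StatisticalMechanics.lennardJones) < (∫ μ, Literature.MathematicalPhysics.StatisticalMechanics.rootEnergy Literature.MathematicalPhysics.StatisticalMechanics.lennardJones μ ∂P) := by
  intro δ hδ P; dsimp only; intro hP ha _hb _hd _he _h0
  exact DiluteRung.frustratedLawGap_dilute_rung δ hδ P hP ha

end Summit.AtomisticToContinuum.Crystallization.Theorems.ShellTopologyTrichotomyFrustratedLaw

end
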